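import Mathlib
import HarnessLib

/-!
# Lekili's wrinkling move `(t² - x² + y² - z² + s t, 2 t x + 2 y z)`: the critical circle

Topic `Literature/Topology/FourManifolds`.  The one rank-ZERO deformation among the moves of
indefinite fibrations: the perturbation of a Lefschetz singularity `(u, v) ↦ u² + v²`
(`u = t + i x`, `v = y + i z`) into a wrinkle (Lekili 2009, §3, Move 4: *"the simplest
non-trivial deformation of such a map is given by … `(u,v) → u² + v² + s Re u` or in real
coordinates `(t,x,y,z) → (t²-x²+y²-z²+st, 2tx+2yz)` … The critical points of `F_s` are the
solutions of `x²+t²+st/2 = 0, y = z = 0`"*; the move `W` of Baykur–Saeki 2017, §3.1, Fig. 6,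
used in the proofs of Prop. 5.1 and Cor. 6.2 there).  This file defines the family and PROVES
the quoted description of its critical set; no named fact is introduced.

* `wrinklingMap s`, `wrinklingDeriv s x`, `hasFDerivAt_wrinklingMap`, `contDiff_wrinklingMap`;
* `surjective_wrinklingDeriv_iff` — **`d(F_s)_x` is onto iff NOT (`y = z = 0` and
  `2(t² + x²) + s t = 0`)**: for `s = 0` the critical set is the origin (the Lefschetz point,
  `surjective_fderiv_wrinklingMap_zero_iff`), for `s ≠ 0` the circle
  `(t + s/4)² + x² = s²/16` in the `(t, x)`-plane.

## References

* Y. Lekili, *Wrinkled fibrations on near-symplectic manifolds*, Geom. Topol. 13 (2009)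
  277–318 (arXiv:0712.2202), §3, Move 4. [Lekili2009]
* R. İ. Baykur, O. Saeki, *Simplifying indefinite fibrations on 4-manifolds*, arXiv:1705.11169,
  §3.1 (move `W`). [BaykurSaeki2017]
-/

noncomputable section

open scoped ContDiff
open Set Function

namespace Literature.Topology.FourManifolds

/-- Local notation: `𝔼 n` is the model Euclidean space `EuclideanSpace ℝ (Fin n)`. -/
local notation "𝔼 " n:arg => EuclideanSpace ℝ (Fin n)

/-! ### The family and its derivative -/

/-- **Lekili's wrinkling family** `F_s : ℝ⁴ → ℝ²`,
`(t, x, y, z) ↦ (t² - x² + y² - z² + s t, 2 t x + 2 y z)` (coordinates `x 0 = t`, `x 1 = x`,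
`x 2 = y`, `x 3 = z`); `F_0` is the Lefschetz model `(u, v) ↦ u² + v²` in `u = t + i x`,
`v = y + i z`. [cite: Lekili2009, §3 Move 4] -/
def wrinklingMap (s : ℝ) (x : 𝔼 4) : 𝔼 2 :=
  (x 0 ^ 2 - x 1 ^ 2 + x 2 ^ 2 - x 3 ^ 2 + s * x 0) • EuclideanSpace.single (0 : Fin 2) (1 : ℝ) +
    (2 * x 0 * x 1 + 2 * x 2 * x 3) • EuclideanSpace.single (1 : Fin 2) (1 : ℝ)

/-- First component of the wrinkling family. [folklore] -/
@[simp] theorem wrinklingMap_apply_zero (s : ℝ) (x : 𝔼 4) :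
    wrinklingMap s x 0 = x 0 ^ 2 - x 1 ^ 2 + x 2 ^ 2 - x 3 ^ 2 + s * x 0 := by
  simp [wrinklingMap]

/-- Second component of the wrinkling family. [folklore] -/
@[simp] theorem wrinklingMap_apply_one (s : ℝ) (x : 𝔼 4) :
    wrinklingMap s x 1 = 2 * x 0 * x 1 + 2 * x 2 * x 3 := by
  simp [wrinklingMap]

/-- The wrinkling family is smooth (a polynomial map). [folklore] -/
theorem contDiff_wrinklingMap (s : ℝ) : ContDiff ℝ ∞ (wrinklingMap s) := by
  have hc : ∀ i : Fin 4, ContDiff ℝ ∞ fun x : 𝔼 4 => x i := fun i =>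
    (EuclideanSpace.proj i : 𝔼 4 →L[ℝ] ℝ).contDiff
  unfold wrinklingMap
  exact ((((((hc 0).pow 2).sub ((hc 1).pow 2)).add ((hc 2).pow 2)).sub ((hc 3).pow 2)).add
    (contDiff_const.mul (hc 0))).smul contDiff_const |>.add
    ((((contDiff_const.mul (hc 0)).mul (hc 1)).add ((contDiff_const.mul (hc 2)).mul (hc 3))).smul
      contDiff_const)

/-- **The derivative of the wrinkling family** at `x`: rows `(2t + s, -2x, 2y, -2z)` and
`(2x, 2t, 2z, 2y)`. [folklore] -/
def wrinklingDeriv (s : ℝ) (x : 𝔼 4) : 𝔼 4 →L[ℝ] 𝔼 2 :=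
  ((2 * x 0 + s) • (EuclideanSpace.proj (0 : Fin 4) : 𝔼 4 →L[ℝ] ℝ) -
        (2 * x 1) • (EuclideanSpace.proj (1 : Fin 4) : 𝔼 4 →L[ℝ] ℝ) +
        (2 * x 2) • (EuclideanSpace.proj (2 : Fin 4) : 𝔼 4 →L[ℝ] ℝ) -
        (2 * x 3) • (EuclideanSpace.proj (3 : Fin 4) : 𝔼 4 →L[ℝ] ℝ)).smulRight
      (EuclideanSpace.single (0 : Fin 2) (1 : ℝ)) +
    ((2 * x 1) • (EuclideanSpace.proj (0 : Fin 4) : 𝔼 4 →L[ℝ] ℝ) +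
        (2 * x 0) • (EuclideanSpace.proj (1 : Fin 4) : 𝔼 4 →L[ℝ] ℝ) +
        (2 * x 3) • (EuclideanSpace.proj (2 : Fin 4) : 𝔼 4 →L[ℝ] ℝ) +
        (2 * x 2) • (EuclideanSpace.proj (3 : Fin 4) : 𝔼 4 →L[ℝ] ℝ)).smulRight
      (EuclideanSpace.single (1 : Fin 2) (1 : ℝ))

/-- First component of the derivative: `(2t + s) v₀ - 2x v₁ + 2y v₂ - 2z v₃`. [folklore] -/
@[simp] theorem wrinklingDeriv_apply_zero (s : ℝ) (x v : 𝔼 4) :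
    wrinklingDeriv s x v 0 =
      (2 * x 0 + s) * v 0 - 2 * x 1 * v 1 + 2 * x 2 * v 2 - 2 * x 3 * v 3 := by
  simp [wrinklingDeriv, ContinuousLinearMap.smulRight_apply]

/-- Second component of the derivative: `2x v₀ + 2t v₁ + 2z v₂ + 2y v₃`. [folklore] -/
@[simp] theorem wrinklingDeriv_apply_one (s : ℝ) (x v : 𝔼 4) :
    wrinklingDeriv s x v 1 = 2 * x 1 * v 0 + 2 * x 0 * v 1 + 2 * x 3 * v 2 + 2 * x 2 * v 3 := by
  simp [wrinklingDeriv, ContinuousLinearMap.smulRight_apply]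

/-- **The wrinkling family has derivative `wrinklingDeriv s x` at `x`.** [folklore] -/
theorem hasFDerivAt_wrinklingMap (s : ℝ) (x : 𝔼 4) :
    HasFDerivAt (wrinklingMap s) (wrinklingDeriv s x) x := by
  have hc : ∀ i : Fin 4, HasFDerivAt (fun x : 𝔼 4 => x i)
      (EuclideanSpace.proj i : 𝔼 4 →L[ℝ] ℝ) x := fun i =>
    (EuclideanSpace.proj i : 𝔼 4 →L[ℝ] ℝ).hasFDerivAt
  have h1 : HasFDerivAt (fun x : 𝔼 4 => x 0 ^ 2 - x 1 ^ 2 + x 2 ^ 2 - x 3 ^ 2 + s * x 0)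
      ((2 * x 0 + s) • (EuclideanSpace.proj (0 : Fin 4) : 𝔼 4 →L[ℝ] ℝ) -
        (2 * x 1) • (EuclideanSpace.proj (1 : Fin 4) : 𝔼 4 →L[ℝ] ℝ) +
        (2 * x 2) • (EuclideanSpace.proj (2 : Fin 4) : 𝔼 4 →L[ℝ] ℝ) -
        (2 * x 3) • (EuclideanSpace.proj (3 : Fin 4) : 𝔼 4 →L[ℝ] ℝ)) x := by
    refine ((((((hc 0).pow 2).sub ((hc 1).pow 2)).add ((hc 2).pow 2)).sub ((hc 3).pow 2)).add
      ((hc 0).const_mul s)).congr_fderiv ?_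
    ext v
    simp
    ring
  have h2 : HasFDerivAt (fun x : 𝔼 4 => 2 * x 0 * x 1 + 2 * x 2 * x 3)
      ((2 * x 1) • (EuclideanSpace.proj (0 : Fin 4) : 𝔼 4 →L[ℝ] ℝ) +
        (2 * x 0) • (EuclideanSpace.proj (1 : Fin 4) : 𝔼 4 →L[ℝ] ℝ) +
        (2 * x 3) • (EuclideanSpace.proj (2 : Fin 4) : 𝔼 4 →L[ℝ] ℝ) +
        (2 * x 2) • (EuclideanSpace.proj (3 : Fin 4) : 𝔼 4 →L[ℝ] ℝ)) x := by
    refine ((((hc 0).const_mul 2).mul (hc 1)).add (((hc 2).const_mul 2).mul (hc 3))).congr_fderiv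
      ?_
    ext v
    simp
    ring
  exact (h1.smul_const _).add (h2.smul_const _)

/-- `fderiv` form of `hasFDerivAt_wrinklingMap`. [folklore] -/
theorem fderiv_wrinklingMap (s : ℝ) (x : 𝔼 4) :
    fderiv ℝ (wrinklingMap s) x = wrinklingDeriv s x :=
  (hasFDerivAt_wrinklingMap s x).fderiv

/-! ### The critical set: `y = z = 0`, `2(t² + x²) + s t = 0` -/

/-- Components `0` and `1` of `dF v = w` as scalar equations. [folklore] -/
theorem wrinklingDeriv_eq_iff (s : ℝ) (x v : 𝔼 4) (w : 𝔼 2) :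
    wrinklingDeriv s x v = w ↔
      (2 * x 0 + s) * v 0 - 2 * x 1 * v 1 + 2 * x 2 * v 2 - 2 * x 3 * v 3 = w 0 ∧
        2 * x 1 * v 0 + 2 * x 0 * v 1 + 2 * x 3 * v 2 + 2 * x 2 * v 3 = w 1 := by
  constructor
  · rintro rfl
    simp
  · rintro ⟨h0, h1⟩
    ext i
    fin_cases i
    · simpa using h0
    · simpa using h1

/-- **The critical set of the wrinkling family** (Lekili 2009, §3, Move 4): `d(F_s)_x` is onto
iff NOT (`x₂ = x₃ = 0` and `2(x₀² + x₁²) + s x₀ = 0`), i.e. the critical points are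
*"the solutions of `x²+t²+st/2 = 0, y = z = 0`"* — a circle through the origin for `s ≠ 0`,
the origin alone (the Lefschetz point) for `s = 0`.  Proof: the `(y, z)`-columns of `dF_s`
have determinant `4(y² + z²)` and the `(t, x)`-columns `2(2(t² + x²) + s t)`; if both vanish
the two rows are proportional (coefficients `(t, x)`, or `(0, 1)` at `t = x = 0`).
[cite: Lekili2009, §3 Move 4] -/
theorem surjective_wrinklingDeriv_iff (s : ℝ) (x : 𝔼 4) :
    Surjective (wrinklingDeriv s x) ↔
      ¬ (x 2 = 0 ∧ x 3 = 0 ∧ 2 * (x 0 ^ 2 + x 1 ^ 2) + s * x 0 = 0) := by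
  constructor
  · rintro hs ⟨h2, h3, hq⟩
    by_cases h01 : x 0 = 0 ∧ x 1 = 0
    · -- both rows vanish in the `x₁`-slot pattern: `(0, 1)` is not a value
      obtain ⟨v, hv⟩ := hs (EuclideanSpace.single (1 : Fin 2) (1 : ℝ))
      obtain ⟨-, h1⟩ := (wrinklingDeriv_eq_iff s x v _).mp hv
      rw [h01.1, h01.2, h2, h3] at h1
      simp at h1
    · -- the rows are proportional with coefficients `(x₀, x₁)`: `(x₀, x₁)` is not a value
      obtain ⟨v, hv⟩ := hs (WithLp.toLp 2 ![x 0, x 1])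
      obtain ⟨h0, h1⟩ := (wrinklingDeriv_eq_iff s x v _).mp hv
      simp only [Matrix.cons_val_zero, Matrix.cons_val_one] at h0 h1
      rw [h2, h3] at h0 h1
      have hsq : x 0 ^ 2 + x 1 ^ 2 = 0 := by
        linear_combination -(x 0 * h0) - x 1 * h1 + v 0 * hq
      have hx0 : x 0 = 0 := by nlinarith [sq_nonneg (x 0), sq_nonneg (x 1)]
      have hx1 : x 1 = 0 := by nlinarith [sq_nonneg (x 0), sq_nonneg (x 1)]
      exact h01 ⟨hx0, hx1⟩
  · intro hx w
    by_cases hyz : x 2 = 0 ∧ x 3 = 0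
    · -- solve with the `(t, x)`-columns, determinant `2q`, `q = 2(t² + x²) + s t ≠ 0`
      obtain ⟨h2, h3⟩ := hyz
      have hq : 2 * (x 0 ^ 2 + x 1 ^ 2) + s * x 0 ≠ 0 := fun hq => hx ⟨h2, h3, hq⟩
      set q := 2 * (x 0 ^ 2 + x 1 ^ 2) + s * x 0 with hq_def
      refine ⟨WithLp.toLp 2 ![(2 * x 0 * w 0 + 2 * x 1 * w 1) / (2 * q),
        ((2 * x 0 + s) * w 1 - 2 * x 1 * w 0) / (2 * q), 0, 0], ?_⟩
      rw [wrinklingDeriv_eq_iff]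
      simp only [Matrix.cons_val_zero, Matrix.cons_val_one, Matrix.cons_val]
      rw [h2, h3]
      constructor
      · field_simp
        ring
      · field_simp
        ring
    · -- solve with the `(y, z)`-columns, determinant `4(y² + z²) ≠ 0`
      have hr : x 2 ^ 2 + x 3 ^ 2 ≠ 0 := by
        intro hr
        have hy : x 2 = 0 := by nlinarith [sq_nonneg (x 2), sq_nonneg (x 3)]
        have hz : x 3 = 0 := by nlinarith [sq_nonneg (x 2), sq_nonneg (x 3)]
        exact hyz ⟨hy, hz⟩
      set r := x 2 ^ 2 + x 3 ^ 2 with hr_def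
      refine ⟨WithLp.toLp 2 ![0, 0, (x 2 * w 0 + x 3 * w 1) / (2 * r),
        (x 2 * w 1 - x 3 * w 0) / (2 * r)], ?_⟩
      rw [wrinklingDeriv_eq_iff]
      simp only [Matrix.cons_val_zero, Matrix.cons_val_one, Matrix.cons_val]
      constructor
      · field_simp
        ring
      · field_simp
        ring

/-- `fderiv` form of the critical-set criterion. [cite: Lekili2009, §3 Move 4] -/
theorem surjective_fderiv_wrinklingMap_iff (s : ℝ) (x : 𝔼 4) :
    Surjective (fderiv ℝ (wrinklingMap s) x) ↔
      ¬ (x 2 = 0 ∧ x 3 = 0 ∧ 2 * (x 0 ^ 2 + x 1 ^ 2) + s * x 0 = 0) := by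
  rw [fderiv_wrinklingMap, surjective_wrinklingDeriv_iff]

/-- **Before wrinkling (`s = 0`) the only critical point is the origin** — the Lefschetz
point of `(u, v) ↦ u² + v²`. [folklore] -/
theorem surjective_fderiv_wrinklingMap_zero_iff (x : 𝔼 4) :
    Surjective (fderiv ℝ (wrinklingMap 0) x) ↔ x ≠ 0 := by
  rw [surjective_fderiv_wrinklingMap_iff]
  refine not_congr ⟨fun ⟨h2, h3, hq⟩ => ?_, fun h => by subst h; simp⟩
  have h0 : x 0 = 0 := by nlinarith [sq_nonneg (x 0), sq_nonneg (x 1)]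
  have h1 : x 1 = 0 := by nlinarith [sq_nonneg (x 0), sq_nonneg (x 1)]
  ext i
  fin_cases i
  · simpa using h0
  · simpa using h1
  · simpa using h2
  · simpa using h3

/-- **The critical circle of the wrinkle**: for every `s`, a point with `y = z = 0` is
critical iff `(t + s/4)² + x² = (s/4)²` — a round circle of radius `|s|/4` through the origin
in the `(t, x)`-plane (Lekili 2009, §3, Move 4: *"This circle can be parametrized by
`t = -s/4 (1 + cos θ)`, `x = s/4 sin θ`"*). [cite: Lekili2009, §3 Move 4] -/
theorem not_surjective_fderiv_wrinklingMap_iff (s : ℝ) (x : 𝔼 4) :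
    ¬ Surjective (fderiv ℝ (wrinklingMap s) x) ↔
      x 2 = 0 ∧ x 3 = 0 ∧ (x 0 + s / 4) ^ 2 + x 1 ^ 2 = (s / 4) ^ 2 := by
  rw [surjective_fderiv_wrinklingMap_iff, not_not]
  refine and_congr Iff.rfl (and_congr Iff.rfl ⟨fun h => ?_, fun h => ?_⟩) <;> linarith

end Literature.Topology.FourManifolds

end
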